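/-
Origin: expansion seat `planner-pub-hodgecm-mc-axioms-1-g14-0`, handover #W3 2026-08-20T15:53:55Z md5 13302b9a0cf1 (PKG 42f67ca05d3a → 13302b9a0cf1; 162 l.; MECHANICAL (iib-R) rewrite v3.1 of the PKG file as it stands (51 token edits; rules R1x1+R2x2+RX[h₂']x44+R8x4)) (`HOME/mc/pub-hodgecm-mc-axioms-1-g14/revendor/kit-r55/stage55/HodgeCM/Model/TranslDischarge.lean`, md5 13302b9a0cf1, 162 lines);
landed by the gen-22 packager (p-g22) in gate run 55 REPLACES the earlier landed copy of `HodgeCM/Model/TranslDischarge.lean` (seat copy carried the packager Origin header of an earlier run (stripped)).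
-/
/-
Origin: CONSTRUCTION seat `planner-pub-hodgecm-mc-glue-1-g4-0` (unit pub-hodgecm-mc-glue-1-g4, gen 4 of mc-glue-1,
node E ASSEMBLER — E-junction of node D1-aut CLASSMAP (N33b)), 2026-08-19.  NEW additive leaf
`HodgeCM/Model/TranslDischarge.lean`.  Imports: `ThetaSpaceInputPin` (mc-theta-3-g3: the pin `thetaSpaceInputOf`,
`thetaOf_thetaSpaceInputOf_of_isAnisotropic`), `ClassMapTranslate` (mc-autform-2-g4: the PKG half of the tree
junction (C3) `UnitaryBallClassMapTranslate`, Borel 1997 §5.13–5.15 reproduced in kernel), `CoverInstance` /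
`E2Instance` (`coverOf`, `thetaModelOf`), `BallInstance` (via the pin: `ballOf`, `two_lt_finrank_of_goodCtx`).
No proof holes, no `def`, nothing cited: kernel lemmas over the readouts `hHD`, `hI`.
Expected `#print axioms`: {propext, Classical.choice, Quot.sound}.
-/
import Summits.HodgeConjecture.HodgeCM.Model.ThetaSpaceInputPin_2
import Summits.HodgeConjecture.HodgeCM.Model.ClassMapTranslate
import Summits.HodgeConjecture.HodgeCM.Model.CoverInstance
import Summits.HodgeConjecture.HodgeCM.Model.E2Instance

/-!
# E's binder `transl` at the theta-space pin: discharge modulo translation-stability of the theta spaces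

E (revisions 6–10, `Model/E2InstanceR*.lean`) carries the ball-facts binder

* `transl : ∀ V c (hc : T.GoodCtx ι₁ c) (hK : [c.K:ℚ] = 6), ∀ γ ∈ ball.Δ, ∀ i Γ ω, ω ∈ T.Theta V c i Γ →
    ∃ Γ' ω', ω' ∈ T.Theta V c i Γ' ∧ ball.ev Γ' ω' = fun x ↦ ball.J γ x *ᵥ ball.ev Γ ω (γ • x)`

("the pull-back of the holomorphic lift of a theta class by a rational `γ` is again the lift of a theta class,
at some level"), with `ball := Model.ballOf …` (period lane: `ev Γ = classLift` in the uniform frame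
`ballFrame`, `J γ x = (Jac γ x)ᵀ`, `Δ = BallRational.ratImage …`) and, since revision 9, the theta sets PINNED:
`T.Theta V c i Γ = thetaOf _ (thetaClassInputOf _ (fun V c ↦ thetaSpaceInputOf hHD hI h₁ hU h₃ S V c)) V c i Γ`,
which in the regime is `thetaClasses id (D Γ) (Θ i Γ)` through (C2)'s class-map datum
(`Model.thetaOf_thetaSpaceInputOf_of_isAnisotropic`) and `{0}` off it.

mc-autform-2-g4's `Model.exists_mem_thetaClasses_classLift_eq_translate_of_apply_eq` (over the tree junction
(C3)) says exactly: theta classes of `(D_Γ, Θ)` translate to theta classes of `(D_Γ', Θ')` with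
`classLift ω' = fun z ↦ (Jac γ z)ᵀ *ᵥ classLift ω (γ • z)` PROVIDED every `F ∈ Θ` has a partner `F' ∈ Θ'` with
`F' g = F (γ g)`.  Read at the pin (`GU := U(2,1)`, `ιinf := id`, both frames `= ballFrame`) this turns the
binder `transl` into a property of the adelic DATA `S` alone:

* `hStab : ∀ V c (hV : IsAnisotropic L V.Hm), ∀ γ ∈ BallRational.ratImage …, ∀ i Γ, ∃ Γ', ∀ F ∈ Θ_S i Γ,
    ∃ F' ∈ Θ_S i Γ', ∀ g, F'.1 g = F.1 (γ * g)` — the classical theta spaces `Θ_S i Γ :=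
  (thetaSpaceInputIn … (S V c) hV).Θ i Γ = thetaSpaceOf (S.P i) (S.ιinf Γ) (levelImage Γ) …` (spans of
  archimedean restrictions of adelic theta forms) are stable under LEFT translation by `L`-rational
  elements of `U(2,1)`, up to shrinking the level.  (Automorphy of the adelic theta functions under
  `G_U(L⁺)` plus right-translation by the finite-adelic component of `γ`; its kernel discharge from the
  structure of `S` is the theta lane's, like `hι` of `Model/ThetaSatDischarge`.)

Main statements: `Model.transl_thetaSpaceInputOf_of_isAnisotropic` (one level pair, regime),
`Model.translOf` (E's binder verbatim, as a term over `hStab`; off the regime nothing is asked since the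
binder is guarded by `T.GoodCtx ι₁ c ∧ [c.K:ℚ] = 6 ⇒ 2 < [L:ℚ] ⇒ V.Hm anisotropic`).
-/

set_option autoImplicit false

noncomputable section

open MulAction NumberField
open scoped Matrix TensorProduct
open Literature.Geometry.ComplexHyperbolic.BallModel (U21 Ball Jac x₀)
open Literature.NumberTheory.Automorphic
open Literature.NumberTheory.Automorphic.WeightForms (ClassMapDatum thetaClasses restrictHom IsLevelCorrected
  IsWeightMatched)
open Literature.AlgebraicGeometry.HodgeTheory
open Literature.AlgebraicGeometry.ShimuraVarieties
open Literature.NumberTheory.Automorphic.PicardCM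
open Literature.NumberTheory.Transcendental (Arapura2012_Cor_15_4_6)
open HodgeCM.Model.ThetaSpace

namespace HodgeCM
namespace Model

section Transl

variable (hHD : exists_isReal_hodgeModel) (hI : hodgePQ_independent_of_hodgeModel)
  (h₁ : BallQuotientUniformised)  (h₃ : CMAbelianVarietyRealised)
variable (S : ∀ {L : CMField} {ι₁ : L →+* ℂ} (V : HermSpace3 L ι₁) (c : SeesawCtx L), ThetaAdelicSide V c)
variable {L : CMField} {ι₁ : L →+* ℂ}

/-- **`transl` at the pin, in the regime, one level pair.** If every form of the classical theta space
`Θ i Γ` has a left-`γ`-translate partner in `Θ i Γ'`, every pinned theta class `ω ∈ Θ_i(Γ)` has a pinned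
theta class `ω' ∈ Θ_i(Γ')` whose holomorphic lift (uniform frame) is the pull-back of that of `ω` by `γ`:
mc-autform-2-g4's `exists_mem_thetaClasses_classLift_eq_translate_of_apply_eq` at `GU := U(2,1)`,
`ιinf := id`, frames `frameOf Γ = frameOf Γ' = ballFrame`. -/
theorem transl_thetaSpaceInputOf_of_isAnisotropic (V : HermSpace3 L ι₁) (c : SeesawCtx L)
    (hV : IsAnisotropic L V.Hm) (γ : U21) (i : Fin 4) (Γ Γ' : Level V)
    (hΘ : ∀ F ∈ (thetaSpaceInputIn hHD hI h₁ h₃ (S V c) hV).Θ i Γ,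
      ∃ F' ∈ (thetaSpaceInputIn hHD hI h₁ h₃ (S V c) hV).Θ i Γ', ∀ g : U21,
        F'.1 g = F.1 (γ * g))
    {ω : (picardCMUniverse hHD hI h₁ h₃).CohC ((picardCMUniverse hHD hI h₁ h₃).pms L ι₁ V Γ) 1}
    (hω : ω ∈ thetaOf _ (thetaClassInputOf _ (fun V c => thetaSpaceInputOf hHD hI h₁ h₃ S V c)) V c i Γ) :
    ∃ ω' : (picardCMUniverse hHD hI h₁ h₃).CohC ((picardCMUniverse hHD hI h₁ h₃).pms L ι₁ V Γ') 1,
      ω' ∈ thetaOf _ (thetaClassInputOf _ (fun V c => thetaSpaceInputOf hHD hI h₁ h₃ S V c)) V c i Γ' ∧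
      (ballDatumOf (hHD := hHD) (hI := hI) (hU := ballQuotientUniformisedDatum_of h₁) (h₃ := h₃)
          L ι₁ V Γ' hV).classLift hHD (frameOf hHD hI h₁ h₃ Γ' hV) ω' =
        fun z ↦ (Jac γ z)ᵀ *ᵥ
          (ballDatumOf (hHD := hHD) (hI := hI) (hU := ballQuotientUniformisedDatum_of h₁) (h₃ := h₃)
            L ι₁ V Γ hV).classLift hHD (frameOf hHD hI h₁ h₃ Γ hV) ω (γ • z) := by
  rw [thetaOf_thetaSpaceInputOf_of_isAnisotropic hHD hI h₁ h₃ S V c i Γ hV] at hω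
  rw [thetaOf_thetaSpaceInputOf_of_isAnisotropic hHD hI h₁ h₃ S V c i Γ' hV]
  obtain ⟨ω', hω', heq⟩ := exists_mem_thetaClasses_classLift_eq_translate_of_apply_eq hHD hI h₁ h₃ Γ Γ'
    hV hV (frameOf hHD hI h₁ h₃ Γ hV) (frameOf hHD hI h₁ h₃ Γ' hV) (MonoidHom.id U21)
    (isLevelCorrected_id _ _ _) (isWeightMatched_id _ _) (isWeightMatched_id _ _) (isLevelCorrected_id _ _ _)
    ((thetaSpaceInputIn hHD hI h₁ h₃ (S V c) hV).Θ i Γ) ((thetaSpaceInputIn hHD hI h₁ h₃ (S V c) hV).Θ i Γ')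
    γ hω (fun F hF => by
      obtain ⟨F', hF', hh⟩ := hΘ F hF
      exact ⟨F', hF', fun g => hh g⟩)
  exact ⟨ω', hω', heq⟩

/-- **E's binder `transl`, verbatim** (E R6–R10 shape: theta sets `(thetaModelOf … Θ d12 d34).Theta` at the pin
`Θ := thetaOf _ (thetaClassInputOf _ (fun V c ↦ thetaSpaceInputOf … S V c))`, ball `Model.ballOf`), as a term
over the adelic side `S` and the translation-stability `hStab` of its classical theta spaces.  The regime is
forced by the binder's own guard (`GoodCtx ∧ [c.K:ℚ] = 6 ⇒ 2 < [L:ℚ]`, `two_lt_finrank_of_goodCtx`,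
`isAnisotropic_of_two_lt`).  E-side: `transl := Model.translOf hHD hI h₁ hU h₃ S h emb wm d12 d34 hA hStab`. -/
theorem translOf (h : Bool)
    (emb : ∀ {L : CMField} {ι₁ : L →+* ℂ} {V : HermSpace3 L ι₁} (Γ : Level V),
      (picardCMUniverse hHD hI h₁ h₃).CohC ((picardCMUniverse hHD hI h₁ h₃).pms L ι₁ V Γ) 2 →ₗ[ℂ]
        (V.latticeModel printFact_unitaryCompact_holds).toQuotientModel.H)
    (wm : ∀ {L : CMField} {ι₁ : L →+* ℂ} (V : HermSpace3 L ι₁) (c : SeesawCtx L),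
      WeilThetaModel (V.latticeModel printFact_unitaryCompact_holds).toQuotientModel.G
        (V.latticeModel printFact_unitaryCompact_holds).toQuotientModel.Γ
        (c.D.latticeModelW printFact_unitaryCompact_holds).toQuotientModel.G
        (c.D.latticeModelW printFact_unitaryCompact_holds).toQuotientModel.Γ)
    (d12 d34 : ∀ {L : CMField}, SeesawCtx L → HodgeCM.Universe.SideData L)
    (hA : Arapura2012_Cor_15_4_6)
    (hStab : ∀ {L : CMField} {ι₁ : L →+* ℂ} (V : HermSpace3 L ι₁) (c : SeesawCtx L) (hV : IsAnisotropic L V.Hm),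
      ∀ γ ∈ BallRational.ratImage L ι₁ V.Hm V.sylvesterFrame (sylvesterFrame_J V), ∀ (i : Fin 4) (Γ : Level V),
      ∃ Γ' : Level V, ∀ F ∈ (thetaSpaceInputIn hHD hI h₁ h₃ (S V c) hV).Θ i Γ,
        ∃ F' ∈ (thetaSpaceInputIn hHD hI h₁ h₃ (S V c) hV).Θ i Γ', ∀ g : U21,
          F'.1 g = F.1 (γ * g))
    {L : CMField} {ι₁ : L →+* ℂ} (V : HermSpace3 L ι₁) (c : SeesawCtx L)
    (hc : (thetaModelOf hHD hI h₁ h₃ h emb (coverOf hHD hI h₁ h₃ hA) wm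
      (thetaOf _ (thetaClassInputOf _ (fun V c => thetaSpaceInputOf hHD hI h₁ h₃ S V c))) d12 d34).GoodCtx ι₁ c)
    (hK : Module.finrank ℚ c.K = 6) :
    ∀ γ ∈ (ballOf hHD hI h₁ h₃ V c (two_lt_finrank_of_goodCtx hHD hI h₁ h₃ hc hK)).Δ,
      ∀ (i : Fin 4) (Γ : Level V)
        (ω : (picardCMUniverse hHD hI h₁ h₃).CohC ((picardCMUniverse hHD hI h₁ h₃).pms L ι₁ V Γ) 1),
      ω ∈ (thetaModelOf hHD hI h₁ h₃ h emb (coverOf hHD hI h₁ h₃ hA) wm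
        (thetaOf _ (thetaClassInputOf _ (fun V c => thetaSpaceInputOf hHD hI h₁ h₃ S V c))) d12 d34).Theta
          V c i Γ →
      ∃ (Γ' : Level V)
        (ω' : (picardCMUniverse hHD hI h₁ h₃).CohC ((picardCMUniverse hHD hI h₁ h₃).pms L ι₁ V Γ') 1),
        ω' ∈ (thetaModelOf hHD hI h₁ h₃ h emb (coverOf hHD hI h₁ h₃ hA) wm
          (thetaOf _ (thetaClassInputOf _ (fun V c => thetaSpaceInputOf hHD hI h₁ h₃ S V c))) d12 d34).Theta
            V c i Γ' ∧
        (ballOf hHD hI h₁ h₃ V c (two_lt_finrank_of_goodCtx hHD hI h₁ h₃ hc hK)).ev Γ' ω' =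
          fun x => (ballOf hHD hI h₁ h₃ V c (two_lt_finrank_of_goodCtx hHD hI h₁ h₃ hc hK)).J γ x *ᵥ
            (ballOf hHD hI h₁ h₃ V c (two_lt_finrank_of_goodCtx hHD hI h₁ h₃ hc hK)).ev Γ ω (γ • x) := by
  intro γ hγ i Γ ω hω
  have hL : 2 < Module.finrank ℚ L := two_lt_finrank_of_goodCtx hHD hI h₁ h₃ hc hK
  have hV : IsAnisotropic L V.Hm := isAnisotropic_of_two_lt L ι₁ V Γ hL
  obtain ⟨Γ', hΘ⟩ := hStab V c hV γ hγ i Γ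
  obtain ⟨ω', hω', heq⟩ :=
    transl_thetaSpaceInputOf_of_isAnisotropic hHD hI h₁ h₃ S V c hV γ i Γ Γ' hΘ hω
  exact ⟨Γ', ω', hω', heq⟩

end Transl

end Model
end HodgeCM

end
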